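import Mathlib
import Literature.Computability.Complexity.RandomKSatEnsembleOGP
import Summits.PneNP.PneNP.Theorems.OverlapGapAlgebraNoStableSectionDefs
import Summits.PneNP.PneNP.Theorems.OverlapGapAlgebraNoStableSectionCount
import Summits.PneNP.PneNP.Theorems.OverlapGapAlgebraSearchHardWindowMoat
import Summits.PneNP.PneNP.Theorems.OverlapGapAlgebraSearchHardWindowMoatTransfer

/-!
# Route OverlapGapAlgebra, crux `SearchHardWindow` (stmt-PneNP-2460), line `Sketch`: few candidates
# of low conditional overlap entropy

Stub `stub_lowEntropyCount` of the skeleton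
`Summits/PneNP/PneNP/Cruxes/SearchHardWindow/Lines/Sketch.lean` (section `Chaos`), the counting
input of the first moment behind the CHAOS lemma (Huang–Sellke 2025, arXiv:2501.06427, Lemma 3.23;
Bresler–Huang 2021, arXiv:2106.02129, §4.6, the count behind `S_indep`, method of types): for
`j ≥ 1` and any earlier rungs `prev 0, …, prev (j-1)`, the candidates `x` whose (unordered,
Bresler–Huang) conditional overlap entropy given the earlier rungs is `≤ β` number at most
`(n+1)^(2^j) · exp(n β)`.

Proof: the sequence `(prev 0, …, prev (j-1), x, x, …)` is `withRung prev j x`; by the bridge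
`mtr_overlapCondEnt_eq_condEnt` its conditional overlap entropy is the DartGame ordered conditional
type entropy `condEnt` of the rung-`0`-normalised sequence, and normalisation by the FIXED vector
`prev 0` (`j ≥ 1`) commutes with `withRung` (`moat_norm_withRung`). So the set to count is the
preimage, under the injection `x ↦ x ⊕ prev 0`, of the set counted by the DartGame theorem
`card_filter_condEnt_le` for the normalised prefix.
-/

set_option linter.dupNamespace false -- `Summit.PneNP.PneNP.…`: summit = sub-problem

namespace Summit.PneNP.PneNP.Theorems

open Finset
open Literature.Computability.Complexity
open Summit.PneNP.PneNP.Cruxes.NoStableSection.DartGame (condEnt withRung withRung_of_lt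
  card_filter_condEnt_le)
open scoped Classical

/-- Pointwise: for `j ≥ 1`, the conditional overlap entropy of the candidate `x` given the rungs
`prev 0, …, prev (j-1)` is the DartGame conditional type entropy of the normalised candidate
`x ⊕ prev 0` given the normalised prefix `(prev ℓ ⊕ prev 0)_ℓ`. -/
theorem lec_overlapCondEnt_eq (n j : ℕ) (hj : 1 ≤ j) (prev : ℕ → Fin n → Bool)
    (x : Fin n → Bool) :
    overlapCondEnt (fun ℓ => if ℓ < j then prev ℓ else x) j =
      condEnt (withRung (fun ℓ i => Bool.xor (prev ℓ i) (prev 0 i)) j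
        (fun i => Bool.xor (x i) (prev 0 i))) j := by
  have h1 : (fun ℓ => if ℓ < j then prev ℓ else x) = withRung prev j x := rfl
  rw [h1, mtr_overlapCondEnt_eq_condEnt, withRung_of_lt prev j x hj, moat_norm_withRung]

/-- **Few candidates of low conditional overlap entropy** (stub `stub_lowEntropyCount` of line
`Sketch`, section `Chaos`; Bresler–Huang 2021 §4.6, the count behind `S_indep`, = DartGame
`card_filter_condEnt_le` transported through the normalisation `x ↦ x ⊕ prev 0`): for `j ≥ 1` and
any earlier rungs `prev 0, …, prev (j-1)`,
`#{x : H(x | prev 0 … prev (j-1)) ≤ β} ≤ (n+1)^{2^j} e^{nβ}`. -/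
theorem stub_lowEntropyCount (n j : ℕ) (hj : 1 ≤ j) (prev : ℕ → Fin n → Bool) (β : ℝ) :
    ((univ.filter fun x : Fin n → Bool =>
        overlapCondEnt (fun ℓ => if ℓ < j then prev ℓ else x) j ≤ β).card : ℝ)
      ≤ ((n : ℝ) + 1) ^ (2 ^ j) * Real.exp (n * β) := by
  -- the normalised prefix
  set R' : ℕ → Fin n → Bool := fun ℓ i => Bool.xor (prev ℓ i) (prev 0 i) with hR'
  -- the set to count injects, by `x ↦ x ⊕ prev 0`, into the set counted by the DartGame theorem
  have hle : (univ.filter fun x : Fin n → Bool =>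
        overlapCondEnt (fun ℓ => if ℓ < j then prev ℓ else x) j ≤ β).card ≤
      (univ.filter fun v : Fin n → Bool => condEnt (withRung R' j v) j ≤ β).card := by
    refine card_le_card_of_injOn (fun x i => Bool.xor (x i) (prev 0 i)) (fun x hx => ?_)
      (fun x _ y _ hxy => ?_)
    · rw [mem_coe, mem_filter] at hx ⊢
      refine ⟨mem_univ _, ?_⟩
      rw [← lec_overlapCondEnt_eq n j hj prev x]
      exact hx.2
    · funext i
      exact Bool.xor_left_inj.1 (congrFun hxy i)
  calc ((univ.filter fun x : Fin n → Bool =>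
          overlapCondEnt (fun ℓ => if ℓ < j then prev ℓ else x) j ≤ β).card : ℝ)
      ≤ ((univ.filter fun v : Fin n → Bool => condEnt (withRung R' j v) j ≤ β).card : ℝ) := by
        exact_mod_cast hle
    _ ≤ ((n : ℝ) + 1) ^ (2 ^ j) * Real.exp (n * β) := card_filter_condEnt_le n j R' β

end Summit.PneNP.PneNP.Theorems
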